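import Mathlib.Analysis.Complex.HasPrimitives
import Mathlib.Analysis.Complex.Schwarz
import Mathlib.Analysis.Complex.ReImTopology
import Mathlib.Analysis.Complex.Convex
import Mathlib.Analysis.Calculus.Deriv.Star
import Mathlib.Topology.MetricSpace.Lipschitz
import HarnessLib

/-!
# The Schwarz reflection principle across the real axis

Trunk T-STOCH support (complex analysis; used for the boundary behaviour of the Loewner maps
`g_t` at real points off the hull, Lawler (2005), Ch. 4 §4.1, "easy to show using Schwarz
reflection", `Literature.Probability.RandomPlanarGeometry.LoewnerRealPointProofs`).

* `Complex.differentiableOn_of_continuousOn_of_differentiableAt_off_im_ne` (any horizontal line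
  `im z = c`, `E`-valued) and its case `c = 0`,
  `Complex.differentiableOn_of_continuousOn_of_differentiableAt_off_real` — **Painlevé's
  theorem for a line**: a function continuous on an open set `U` and holomorphic on `U` off the
  line is holomorphic on `U` (Morera: the rectangle integrals vanish, splitting a rectangle which
  crosses the line into two rectangles with an edge on it; Rudin, *Real and Complex Analysis*,
  Thm. 11.14 proof / Conway IX.1.1 proof).
* `Complex.differentiableOn_schwarzReflection` — the **Schwarz reflection principle** (Conway,
  *Functions of One Complex Variable I*, IX.1.1; Rudin 11.14): if `U` is open and symmetric
  under conjugation, `f` is continuous on `U ∩ {im ≥ 0}`, holomorphic on `U ∩ {im > 0}` and real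
  on `U ∩ ℝ`, then `schwarzReflection f` (`= f` on `im ≥ 0`, `= conj ∘ f ∘ conj` below) is
  holomorphic on `U`.
* `Complex.norm_deriv_le_two_mul_im_div` — the **Schwarz–Pick estimate for maps into the upper
  half-plane**: `f : B(c, R) → ℍ` holomorphic ⇒ `‖f'(c)‖ ≤ 2 im f(c) / R` (Schwarz's lemma for
  `(f - a)/(f - ā)`, `a = f(c)`).
* `Complex.exists_differentiableOn_extension_of_im_le` — the package used for Loewner maps: a
  holomorphic `g` on the half-disc `B(x, r) ∩ ℍ` with `0 < im g ≤ im` is `2`-Lipschitz on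
  `B(x, r/2) ∩ ℍ` (Schwarz–Pick), hence extends continuously and with real values to the
  diameter (McShane extension of `re g`, `im g`), and its reflection is holomorphic on
  `B(x, r/2)`, agrees with `g` on the upper half, is real on the diameter, maps the lower half
  into the lower half-plane, and is `4`-Lipschitz on the closed upper half-disc.

## Mathlib

We USE `Complex.isConservativeOn_and_continuousOn_iff_isDifferentiableOn` (Morera's theorem,
`Mathlib.Analysis.Complex.HasPrimitives`), `Complex.integral_boundary_rect_eq_zero_of_differentiable_on_off_countable`
(Cauchy–Goursat for a rectangle with continuity on the closed rectangle only),
`Complex.norm_deriv_le_div_of_mapsTo_ball` (Schwarz's lemma), `DifferentiableAt.conj_conj`,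
`ContinuousOn.if`, `Complex.frontier_setOf_le_im`, `Complex.closure_setOf_im_lt`,
`Convex.lipschitzOnWith_of_nnnorm_deriv_le`, `LipschitzOnWith.extend_real` (McShane). Mathlib
has no reflection principle (`rg -i "schwarz reflection" Mathlib` is empty).

## Existing tree declarations (search) — refactor note for the librarian

Two files of the tree already carry *ad hoc* copies of parts of this material, each kept local
to avoid imports (`lean search 'off_real|off_im_eq|norm_deriv_le_two|differentiableOn_reflect'`):

* `Literature.Analysis.FunctionSpaces.differentiableOn_of_continuousOn_of_differentiableOn_off_im_eq`
  (`Literature/Analysis/FunctionSpaces/KMSStates.lean`, `E`-valued, any horizontal line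
  `im z = c`, hypothesis `DifferentiableOn ℂ f (U ∖ {im = c})`) and
  `Literature.Probability.RandomPlanarGeometry.SchwarzReflection.differentiableOn_of_off_real`
  (`Literature/Probability/RandomPlanarGeometry/RestrictionHullsProofs.lean`, the line `im = 0`)
  are the Painlevé/Morera step; here
  `Complex.differentiableOn_of_continuousOn_of_differentiableAt_off_im_ne` (any height `c`,
  `E`-valued, pointwise hypothesis `DifferentiableAt` off the line — equivalent on the open set
  `U ∖ {im = c}`) and its `c = 0` corollary
  `Complex.differentiableOn_of_continuousOn_of_differentiableAt_off_real`;
* `Literature.Probability.RandomPlanarGeometry.SchwarzReflection.differentiableOn_reflect` (`RestrictionHullsProofs.lean`; the disc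
  `B(0, r)`, `G` continuous on all of `ℂ`) is the special case `U = B(0, r)` of
  `Complex.differentiableOn_schwarzReflection` (any open conjugation-symmetric `U`, continuity
  only on `U ∩ {im ≥ 0}`);
* `Literature.Probability.RandomPlanarGeometry.HalfPlanePick.norm_deriv_le_two_mul_im_div` (`RestrictionHullsProofs.lean`; hypothesis
  `MapsTo f (ball c R) ℍₒ`) has the same statement as `Complex.norm_deriv_le_two_mul_im_div`
  below (hypothesis `∀ z ∈ ball c R, 0 < im f z`);
* `Literature.Probability.RandomPlanarGeometry.IsRestrictionMap.norm_deriv_le_two`, `IsRestrictionMap.lipschitzOnWith`,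
  `IsRestrictionMap.exists_extension`, `IsRestrictionMap.extension_ofReal_im`
  (`RestrictionHullsProofs.lean`, ll. 430 ff., for restriction maps `Φ_A` on `ℍₒ ∩ B(0, r)`) are
  the specialised analogues of `Complex.norm_deriv_le_two_of_im_le`,
  `Complex.lipschitzOnWith_of_im_le` and `Complex.exists_differentiableOn_extension_of_im_le`
  (any half-disc `B(x, r) ∩ ℍ`, `x ∈ ℝ`, any holomorphic `g` with `0 < im g ≤ im`).

refactor: this file (Mathlib-only imports, namespace `Complex`) is the general home; the copies
in `KMSStates.lean` (kept there only because that file imports `QuasiLocalAlgebra`) and in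
`RestrictionHullsProofs.lean` (light imports) can become imports/corollaries of it.

## References

* J. B. Conway, *Functions of One Complex Variable I*, 2nd ed., GTM 11 (1978), Ch. IX §1,
  Thm. 1.1 (Schwarz Reflection Principle), p. 211.
* W. Rudin, *Real and Complex Analysis*, 3rd ed. (1987), Thm. 11.14 (reflection principle).
-/

noncomputable section

open Set Filter Topology Metric
open scoped ComplexConjugate Interval NNReal

namespace Complex

variable {E : Type*} [NormedAddCommGroup E] [NormedSpace ℂ E] [CompleteSpace E]

/-! ### Holomorphy across the real axis (Painlevé / Morera) -/

section Painleve

omit [CompleteSpace E] in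
/-- Cauchy–Goursat for a rectangle in `U` whose open interior misses the horizontal line
`im z = c`, for a function continuous on `U` and holomorphic on `U` off that line. [folklore] -/
theorem boundary_integral_eq_zero_of_off_line {f : ℂ → E} {U : Set ℂ} {c : ℝ}
    (hc : ContinuousOn f U) (hd : ∀ z ∈ U, z.im ≠ c → DifferentiableAt ℂ f z)
    {z w : ℂ} (hzw : Rectangle z w ⊆ U) (h : c ≤ min z.im w.im ∨ max z.im w.im ≤ c) :
    (∫ x : ℝ in z.re..w.re, f (x + z.im * I)) - (∫ x : ℝ in z.re..w.re, f (x + w.im * I)) +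
      I • (∫ y : ℝ in z.im..w.im, f (w.re + y * I)) -
      I • (∫ y : ℝ in z.im..w.im, f (z.re + y * I)) = 0 := by
  refine integral_boundary_rect_eq_zero_of_differentiable_on_off_countable f z w ∅ countable_empty
    (hc.mono hzw) fun p hp ↦ hd p (hzw ?_) ?_
  · have hp' := mem_reProdIm.1 hp.1
    exact ⟨Ioo_subset_Icc_self hp'.1, Ioo_subset_Icc_self hp'.2⟩
  · have hp' := mem_reProdIm.1 hp.1
    rcases h with h | h
    · exact (h.trans_lt hp'.2.1).ne'
    · exact (hp'.2.2.trans_le h).ne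

/-- The rectangle with corners `z, w` is the rectangle with corners `w, z`. [folklore] -/
theorem rectangle_comm (z w : ℂ) : Rectangle z w = Rectangle w z := by
  simp [Rectangle, uIcc_comm]

/-- **Painlevé's theorem for a horizontal line** (holomorphy across `im z = c`; the analytic
core of the Schwarz reflection principle, Conway IX.1.1 / Rudin 11.14, proofs): let `U ⊆ ℂ` be
open and `f : U → E` continuous on `U` and complex differentiable at every point of `U` off the
line `im z = c`. Then `f` is holomorphic on `U`. Proof: by Morera's theorem
(`isConservativeOn_and_continuousOn_iff_isDifferentiableOn`) it suffices that the integral of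
`f` around every rectangle in `U` vanishes; a rectangle not crossing the line is handled by the
Cauchy–Goursat theorem with continuity on the closed rectangle, and a rectangle crossing it is
the sum of two such. (Same statement, with the hypothesis in the equivalent form
`DifferentiableOn ℂ f (U ∖ {im = c})`, as `Literature.Analysis.FunctionSpaces.differentiableOn_of_continuousOn_of_differentiableOn_off_im_eq`
of `KMSStates.lean`, which is not importable here.) [cite: Conway1978, Ch. IX Thm. 1.1] -/
theorem differentiableOn_of_continuousOn_of_differentiableAt_off_im_ne {f : ℂ → E} {U : Set ℂ}
    (hU : IsOpen U) (c : ℝ) (hc : ContinuousOn f U)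
    (hd : ∀ z ∈ U, z.im ≠ c → DifferentiableAt ℂ f z) : DifferentiableOn ℂ f U := by
  refine (isConservativeOn_and_continuousOn_iff_isDifferentiableOn hU).1 ⟨?_, hc⟩
  intro z w hzw
  wlog hle : z.im ≤ w.im generalizing z w
  · have hwz : Rectangle w z ⊆ U := by rwa [rectangle_comm]
    rw [this w z hwz (le_of_not_ge hle), neg_neg]
  rw [← add_eq_zero_iff_eq_neg, wedgeIntegral_add_wedgeIntegral_eq]
  by_cases h0 : c ≤ z.im ∨ w.im ≤ c
  · refine boundary_integral_eq_zero_of_off_line hc hd hzw ?_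
    rcases h0 with h0 | h0
    · exact Or.inl (le_min h0 (h0.trans hle))
    · exact Or.inr (max_le (hle.trans h0) h0)
  -- the rectangle crosses the line `im = c`: split it along the line
  simp only [not_or, not_le] at h0
  obtain ⟨hz0, hw0⟩ := h0
  have h0mem : c ∈ [[z.im, w.im]] := mem_uIcc_of_le hz0.le hw0.le
  have hsub₁ : Rectangle z ⟨w.re, c⟩ ⊆ Rectangle z w := by
    intro p hp
    rw [Rectangle, mem_reProdIm] at hp ⊢
    exact ⟨hp.1, uIcc_subset_uIcc_left h0mem hp.2⟩
  have hsub₂ : Rectangle ⟨z.re, c⟩ w ⊆ Rectangle z w := by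
    intro p hp
    rw [Rectangle, mem_reProdIm] at hp ⊢
    exact ⟨hp.1, uIcc_subset_uIcc_right h0mem hp.2⟩
  have h1 := boundary_integral_eq_zero_of_off_line hc hd (hsub₁.trans hzw)
    (Or.inr (max_le hz0.le le_rfl))
  have h2 := boundary_integral_eq_zero_of_off_line hc hd (hsub₂.trans hzw)
    (Or.inl (le_min le_rfl hw0.le))
  dsimp only at h1 h2
  -- interval integrability of `f` on the vertical edges
  have hvert : ∀ a ∈ [[z.re, w.re]], ContinuousOn (fun y : ℝ ↦ f (a + y * I)) [[z.im, w.im]] := by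
    intro a ha
    refine hc.comp (by fun_prop) fun y hy ↦ hzw ?_
    rw [Rectangle, mem_reProdIm]
    simpa using And.intro ha hy
  have hwre : w.re ∈ [[z.re, w.re]] := right_mem_uIcc
  have hzre : z.re ∈ [[z.re, w.re]] := left_mem_uIcc
  have hI₁ : IntervalIntegrable (fun y : ℝ ↦ f (w.re + y * I)) MeasureTheory.volume z.im c :=
    ((hvert _ hwre).mono (uIcc_subset_uIcc_left h0mem)).intervalIntegrable
  have hI₂ : IntervalIntegrable (fun y : ℝ ↦ f (w.re + y * I)) MeasureTheory.volume c w.im :=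
    ((hvert _ hwre).mono (uIcc_subset_uIcc_right h0mem)).intervalIntegrable
  have hI₃ : IntervalIntegrable (fun y : ℝ ↦ f (z.re + y * I)) MeasureTheory.volume z.im c :=
    ((hvert _ hzre).mono (uIcc_subset_uIcc_left h0mem)).intervalIntegrable
  have hI₄ : IntervalIntegrable (fun y : ℝ ↦ f (z.re + y * I)) MeasureTheory.volume c w.im :=
    ((hvert _ hzre).mono (uIcc_subset_uIcc_right h0mem)).intervalIntegrable
  rw [← intervalIntegral.integral_add_adjacent_intervals hI₁ hI₂,
    ← intervalIntegral.integral_add_adjacent_intervals hI₃ hI₄, smul_add, smul_add]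
  have hsum := congrArg₂ (· + ·) h1 h2
  simp only [add_zero] at hsum
  rw [← hsum]
  abel

/-- **Painlevé's theorem for the real line** (the case `c = 0` of
`differentiableOn_of_continuousOn_of_differentiableAt_off_im_ne`): a function continuous on an
open `U` and complex differentiable on `U` off the real axis is holomorphic on `U`. (Same
statement as `Literature.Probability.RandomPlanarGeometry.SchwarzReflection.differentiableOn_of_off_real` of `RestrictionHullsProofs.lean`,
which is not importable here.) [cite: Conway1978, Ch. IX Thm. 1.1] -/
theorem differentiableOn_of_continuousOn_of_differentiableAt_off_real {f : ℂ → E} {U : Set ℂ}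
    (hU : IsOpen U) (hc : ContinuousOn f U)
    (hd : ∀ z ∈ U, z.im ≠ 0 → DifferentiableAt ℂ f z) : DifferentiableOn ℂ f U :=
  differentiableOn_of_continuousOn_of_differentiableAt_off_im_ne hU 0 hc hd

end Painleve

/-! ### The reflection principle -/

section Reflection

/-- The **Schwarz reflection** of `f : ℂ → ℂ` across the real axis: `f` on the closed upper
half-plane `{im ≥ 0}` and `z ↦ conj (f (conj z))` on the open lower half-plane. Conway,
*Functions of One Complex Variable I*, IX.1.1. [cite: Conway1978, Ch. IX Thm. 1.1] -/
def schwarzReflection (f : ℂ → ℂ) (z : ℂ) : ℂ :=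
  if 0 ≤ z.im then f z else conj (f (conj z))

variable {f : ℂ → ℂ} {z : ℂ}

/-- On the closed upper half-plane the reflection is `f`. [folklore] -/
@[simp]
theorem schwarzReflection_of_nonneg (hz : 0 ≤ z.im) : schwarzReflection f z = f z :=
  if_pos hz

/-- On the open lower half-plane the reflection is `conj ∘ f ∘ conj`. [folklore] -/
theorem schwarzReflection_of_neg (hz : z.im < 0) :
    schwarzReflection f z = conj (f (conj z)) :=
  if_neg (not_le.2 hz)

/-- On the real axis the reflection is `f`. [folklore] -/
@[simp]
theorem schwarzReflection_ofReal (x : ℝ) : schwarzReflection f x = f x :=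
  schwarzReflection_of_nonneg (by simp)

/-- Imaginary part of the reflection below the axis. [folklore] -/
theorem im_schwarzReflection_of_neg (hz : z.im < 0) :
    (schwarzReflection f z).im = -(f (conj z)).im := by
  rw [schwarzReflection_of_neg hz, conj_im]

/-- **The Schwarz reflection principle** (Conway, *Functions of One Complex Variable I*,
Thm. IX.1.1; Rudin, *Real and Complex Analysis*, Thm. 11.14). Let `U ⊆ ℂ` be open and
symmetric under conjugation, and let `f` be continuous on `U ∩ {im ≥ 0}`, holomorphic on
`U ∩ {im > 0}` and real-valued on `U ∩ ℝ`. Then the reflected function `schwarzReflection f`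
is holomorphic on `U`. (Continuity of the glued function along `U ∩ ℝ`, then Painlevé's
theorem `differentiableOn_of_continuousOn_of_differentiableAt_off_real`.)
[cite: Conway1978, Ch. IX Thm. 1.1] -/
theorem differentiableOn_schwarzReflection {U : Set ℂ} (hU : IsOpen U)
    (hsymm : ∀ z ∈ U, conj z ∈ U) (hc : ContinuousOn f (U ∩ {z | 0 ≤ z.im}))
    (hd : DifferentiableOn ℂ f (U ∩ {z | 0 < z.im}))
    (hreal : ∀ z ∈ U, z.im = 0 → conj (f z) = f z) :
    DifferentiableOn ℂ (schwarzReflection f) U := by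
  have hopen : IsOpen (U ∩ {z : ℂ | 0 < z.im}) :=
    hU.inter (isOpen_lt continuous_const continuous_im)
  refine differentiableOn_of_continuousOn_of_differentiableAt_off_real hU ?_ ?_
  · -- continuity of the glued function
    have hcl₁ : closure {a : ℂ | 0 ≤ a.im} = {a | 0 ≤ a.im} :=
      (isClosed_le continuous_const continuous_im).closure_eq
    have hcl₂ : closure {a : ℂ | ¬0 ≤ a.im} = {a | a.im ≤ 0} := by
      have : {a : ℂ | ¬0 ≤ a.im} = {a | a.im < 0} := by ext a; simp [not_le]
      rw [this, closure_setOf_im_lt]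
    refine ContinuousOn.if ?_ ?_ ?_
    · rintro a ⟨haU, ha⟩
      rw [frontier_setOf_le_im] at ha
      have ha' : a.im = 0 := ha
      rw [conj_eq_iff_im.2 ha', hreal a haU ha']
    · rwa [hcl₁]
    · rw [hcl₂]
      refine (continuous_conj.comp_continuousOn (hc.comp continuous_conj.continuousOn ?_))
      rintro a ⟨haU, ha⟩
      refine ⟨hsymm a haU, ?_⟩
      show 0 ≤ (conj a).im
      rw [conj_im]
      have : a.im ≤ 0 := ha
      linarith
  · -- holomorphy off the real axis
    intro z hzU hz
    rcases lt_or_gt_of_ne hz with hneg | hpos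
    · have hev : schwarzReflection f =ᶠ[𝓝 z] (conj ∘ f ∘ conj) := by
        filter_upwards [(isOpen_lt continuous_im continuous_const).mem_nhds hneg] with y hy
        simp [schwarzReflection_of_neg (show y.im < 0 from hy), Function.comp]
      refine DifferentiableAt.congr_of_eventuallyEq ?_ hev
      have hfd : DifferentiableAt ℂ f (conj z) :=
        hd.differentiableAt (hopen.mem_nhds ⟨hsymm z hzU, by simp only [mem_setOf_eq, conj_im]; linarith⟩)
      have := hfd.conj_conj
      rwa [conj_conj] at this
    · have hev : schwarzReflection f =ᶠ[𝓝 z] f := by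
        filter_upwards [(isOpen_lt continuous_const continuous_im).mem_nhds hpos] with y hy
        exact schwarzReflection_of_nonneg (le_of_lt hy)
      refine DifferentiableAt.congr_of_eventuallyEq ?_ hev
      exact hd.differentiableAt (hopen.mem_nhds ⟨hzU, hpos⟩)

end Reflection

/-! ### Schwarz–Pick for maps into the upper half-plane -/

section SchwarzPick

/-- **Schwarz–Pick estimate for holomorphic maps of a disc into the upper half-plane**: if `f`
is holomorphic on `B(c, R)` with `im f > 0` there, then `‖f'(c)‖ ≤ 2 im f(c) / R`. Proof: the
Cayley-type map `w ↦ (w - a)/(w - ā)`, `a = f(c)`, takes `ℍ` into the unit disc and `a` to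
`0`; apply Schwarz's lemma (`norm_deriv_le_div_of_mapsTo_ball`) to its composite with `f`,
whose derivative at `c` is `f'(c)/(a - ā)`, `|a - ā| = 2 im a`. (Equality for the hyperbolic
isometries; Ahlfors, *Complex Analysis*, Ch. 4 §3.4 / Conway VI.2.) Same statement as
`Literature.Probability.RandomPlanarGeometry.HalfPlanePick.norm_deriv_le_two_mul_im_div` of `RestrictionHullsProofs.lean` (there with
`MapsTo f (ball c R) ℍₒ`), which is not importable here. [folklore] -/
theorem norm_deriv_le_two_mul_im_div {f : ℂ → ℂ} {c : ℂ} {R : ℝ} (hR : 0 < R)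
    (hd : DifferentiableOn ℂ f (ball c R)) (hpos : ∀ z ∈ ball c R, 0 < (f z).im) :
    ‖deriv f c‖ ≤ 2 * (f c).im / R := by
  set a : ℂ := f c with ha
  have ha0 : 0 < a.im := hpos c (mem_ball_self hR)
  have hden : ∀ z ∈ ball c R, f z - conj a ≠ 0 := fun z hz h ↦ by
    have := congrArg Complex.im h
    simp only [sub_im, conj_im, zero_im] at this
    linarith [hpos z hz]
  have hne : a - conj a ≠ 0 := fun h ↦ by
    have := congrArg Complex.im h
    simp only [sub_im, conj_im, zero_im] at this
    linarith
  set F : ℂ → ℂ := fun z ↦ (f z - a) / (f z - conj a) with hF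
  have hFd : DifferentiableOn ℂ F (ball c R) := (hd.sub_const a).div (hd.sub_const _) hden
  have hF0 : F c = 0 := by simp [hF, ha]
  have hmaps : MapsTo F (ball c R) (closedBall (F c) 1) := by
    intro z hz
    rw [hF0, mem_closedBall, dist_zero_right, hF]
    dsimp only
    rw [norm_div, div_le_one (norm_pos_iff.2 (hden z hz))]
    have h1 : ‖f z - a‖ ^ 2 ≤ ‖f z - conj a‖ ^ 2 := by
      rw [Complex.sq_norm, Complex.sq_norm, Complex.normSq_apply, Complex.normSq_apply]
      simp only [sub_re, sub_im, conj_re, conj_im]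
      nlinarith [hpos z hz, ha0]
    exact le_of_sq_le_sq h1 (norm_nonneg _)  -- placeholder name
  have hS := norm_deriv_le_div_of_mapsTo_ball hFd hmaps hR
  have hfc : HasDerivAt f (deriv f c) c := (hd.differentiableAt (ball_mem_nhds c hR)).hasDerivAt
  have hFc : HasDerivAt F (deriv f c / (a - conj a)) c := by
    have h1 := (hfc.sub_const a).div (hfc.sub_const (conj a)) (hden c (mem_ball_self hR))
    refine h1.congr_deriv ?_
    simp only [← ha, sub_self, zero_mul, sub_zero]
    rw [pow_two, mul_div_mul_right _ _ hne]
  rw [hFc.deriv, norm_div] at hS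
  have hnorm : ‖a - conj a‖ = 2 * a.im := by
    rw [sub_conj, norm_mul, norm_real, norm_I, mul_one, Real.norm_eq_abs,
      abs_of_pos (by linarith)]
  rw [hnorm, div_le_div_iff₀ (by linarith) hR, one_mul] at hS
  rw [le_div_iff₀ hR]
  linarith

/-- **Derivative bound for half-plane-valued maps with `im g ≤ im` on a half-disc.** If `g` is
holomorphic on `B(x, r) ∩ ℍ` (`x` real) with `0 < im g(z) ≤ im z`, then `‖g'(z)‖ ≤ 2` on
`B(x, r/2) ∩ ℍ` (apply `norm_deriv_le_two_mul_im_div` on the disc `B(z, im z) ⊆ B(x, r) ∩ ℍ`).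
This is the situation of the Loewner maps `g_t` near a real point off the hull. [folklore] -/
theorem norm_deriv_le_two_of_im_le {g : ℂ → ℂ} {x r : ℝ}
    (hd : DifferentiableOn ℂ g (ball (x : ℂ) r ∩ {z | 0 < z.im}))
    (him : ∀ z ∈ ball (x : ℂ) r ∩ {z | 0 < z.im}, 0 < (g z).im ∧ (g z).im ≤ z.im)
    {z : ℂ} (hz : z ∈ ball (x : ℂ) (r / 2)) (hzim : 0 < z.im) : ‖deriv g z‖ ≤ 2 := by
  have hzx : z.im ≤ dist z x := by
    rw [dist_eq_norm]
    exact (le_abs_self _).trans (by simpa using abs_im_le_norm (z - x))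
  rw [mem_ball] at hz
  have hsub : ball z z.im ⊆ ball (x : ℂ) r ∩ {z | 0 < z.im} := by
    intro w hw
    rw [mem_ball] at hw
    constructor
    · rw [mem_ball]
      calc dist w x ≤ dist w z + dist z x := dist_triangle _ _ _
        _ < dist z x + dist z x := by linarith
        _ < r := by linarith
    · show 0 < w.im
      have h1 : |(w - z).im| ≤ dist w z := by rw [dist_eq_norm]; exact abs_im_le_norm _
      rw [sub_im] at h1
      linarith [(abs_le.1 h1).1]
  have h := norm_deriv_le_two_mul_im_div hzim (hd.mono hsub) (fun w hw ↦ (him w (hsub hw)).1)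
  have hgz : (g z).im ≤ z.im := (him z (hsub (mem_ball_self hzim))).2
  calc ‖deriv g z‖ ≤ 2 * (g z).im / z.im := h
    _ ≤ 2 * z.im / z.im := by gcongr
    _ = 2 := by field_simp

/-- In the situation of `norm_deriv_le_two_of_im_le`, `g` is `2`-Lipschitz on the convex set
`B(x, r/2) ∩ ℍ` (mean value inequality). [folklore] -/
theorem lipschitzOnWith_of_im_le {g : ℂ → ℂ} {x r : ℝ}
    (hd : DifferentiableOn ℂ g (ball (x : ℂ) r ∩ {z | 0 < z.im}))
    (him : ∀ z ∈ ball (x : ℂ) r ∩ {z | 0 < z.im}, 0 < (g z).im ∧ (g z).im ≤ z.im) :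
    LipschitzOnWith 2 g (ball (x : ℂ) (r / 2) ∩ {z | 0 < z.im}) := by
  have hopen : IsOpen (ball (x : ℂ) r ∩ {z : ℂ | 0 < z.im}) :=
    isOpen_ball.inter (isOpen_lt continuous_const continuous_im)
  refine Convex.lipschitzOnWith_of_nnnorm_deriv_le (𝕜 := ℂ) (fun z hz ↦ ?_) (fun z hz ↦ ?_)
    ((convex_ball _ _).inter (convex_halfSpace_im_gt 0))
  · refine hd.differentiableAt (hopen.mem_nhds ⟨?_, hz.2⟩)
    have hr : r / 2 ≤ r := by
      have := (dist_nonneg.trans_lt (mem_ball.1 hz.1))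
      linarith
    exact ball_subset_ball hr hz.1
  · have := norm_deriv_le_two_of_im_le hd him hz.1 hz.2
    rw [← NNReal.coe_le_coe, coe_nnnorm]
    exact_mod_cast this

end SchwarzPick

/-! ### Holomorphic extension across the diameter of a half-disc -/

section Extension

/-- Small vertical displacements of a point of the closed upper half of `B(x, ρ)` stay in the
open upper half of `B(x, ρ)`. [folklore] -/
theorem eventually_add_mul_I_mem {x ρ : ℝ} {z : ℂ} (hz : z ∈ ball (x : ℂ) ρ) (hzim : 0 ≤ z.im) :
    ∀ᶠ y : ℝ in 𝓝[>] 0, z + y * I ∈ ball (x : ℂ) ρ ∩ {w | 0 < w.im} := by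
  have hgap : 0 < ρ - dist z x := sub_pos.2 (mem_ball.1 hz)
  have h1 : ∀ᶠ y : ℝ in 𝓝[>] 0, y ∈ Ioo 0 (ρ - dist z x) := Ioo_mem_nhdsGT hgap
  filter_upwards [h1] with y hy
  refine ⟨?_, ?_⟩
  · rw [mem_ball]
    calc dist (z + y * I) x ≤ dist (z + y * I) z + dist z x := dist_triangle _ _ _
      _ = |y| + dist z x := by simp [dist_eq_norm]
      _ < ρ := by rw [abs_of_pos hy.1]; linarith [hy.2]
  · show 0 < (z + y * I).im
    simp only [add_im, mul_im, ofReal_re, I_im, mul_one, ofReal_im, I_re, mul_zero, add_zero]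
    linarith [hy.1]

/-- **Reflection of a holomorphic self-map of the upper half-plane with `im g ≤ im` across a
real segment** (the form of the Schwarz reflection principle used for Loewner chains). Let `g`
be holomorphic on the half-disc `B(x, r) ∩ ℍ` (`x ∈ ℝ`) with `0 < im g(z) ≤ im z`. Then there is
`G` holomorphic on `B(x, r/2)` which agrees with `g` on `B(x, r/2) ∩ ℍ`, is real on the
diameter, maps the lower half-disc into the lower half-plane, and satisfies
`‖G a - G b‖ ≤ 4‖a - b‖` on the closed upper half-disc. Construction: `g` is `2`-Lipschitz on
`B(x, r/2) ∩ ℍ` (`lipschitzOnWith_of_im_le`), so `re g`, `im g` have `2`-Lipschitz extensions to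
`ℂ` (McShane, `LipschitzOnWith.extend_real`); the extension is real on the diameter since
`0 < im g ≤ im → 0`, and its Schwarz reflection is holomorphic
(`differentiableOn_schwarzReflection`). [cite: Conway1978, Ch. IX Thm. 1.1] -/
theorem exists_differentiableOn_extension_of_im_le {g : ℂ → ℂ} {x r : ℝ}
    (hd : DifferentiableOn ℂ g (ball (x : ℂ) r ∩ {z | 0 < z.im}))
    (him : ∀ z ∈ ball (x : ℂ) r ∩ {z | 0 < z.im}, 0 < (g z).im ∧ (g z).im ≤ z.im) :
    ∃ G : ℂ → ℂ, DifferentiableOn ℂ G (ball (x : ℂ) (r / 2)) ∧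
      EqOn G g (ball (x : ℂ) (r / 2) ∩ {z | 0 < z.im}) ∧
      (∀ z ∈ ball (x : ℂ) (r / 2), z.im = 0 → (G z).im = 0) ∧
      (∀ z ∈ ball (x : ℂ) (r / 2), z.im < 0 → (G z).im < 0) ∧
      ∀ a ∈ ball (x : ℂ) (r / 2), 0 ≤ a.im → ∀ b ∈ ball (x : ℂ) (r / 2), 0 ≤ b.im →
        ‖G a - G b‖ ≤ 4 * ‖a - b‖ := by
  set D : Set ℂ := ball (x : ℂ) (r / 2) ∩ {z | 0 < z.im} with hD
  have hDsub : D ⊆ ball (x : ℂ) r ∩ {z | 0 < z.im} := by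
    rintro z ⟨hz, hzim⟩
    refine ⟨ball_subset_ball ?_ hz, hzim⟩
    have := dist_nonneg.trans_lt (mem_ball.1 hz)
    linarith
  have hL : LipschitzOnWith 2 g D := lipschitzOnWith_of_im_le hd him
  -- McShane extensions of the real and imaginary parts
  have hLre : LipschitzOnWith 2 (fun z ↦ (g z).re) D := by
    refine LipschitzOnWith.of_dist_le_mul fun a ha b hb ↦ ?_
    refine le_trans ?_ (hL.dist_le_mul a ha b hb)
    rw [Real.dist_eq, dist_eq_norm, ← sub_re]
    exact abs_re_le_norm _
  have hLim : LipschitzOnWith 2 (fun z ↦ (g z).im) D := by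
    refine LipschitzOnWith.of_dist_le_mul fun a ha b hb ↦ ?_
    refine le_trans ?_ (hL.dist_le_mul a ha b hb)
    rw [Real.dist_eq, dist_eq_norm, ← sub_im]
    exact abs_im_le_norm _
  obtain ⟨G₁, hG₁, hE₁⟩ := hLre.extend_real
  obtain ⟨G₂, hG₂, hE₂⟩ := hLim.extend_real
  set Eg : ℂ → ℂ := fun z ↦ (G₁ z : ℂ) + G₂ z * I with hEg
  have hEcont : Continuous Eg := by
    have h1 := hG₁.continuous
    have h2 := hG₂.continuous
    simp only [hEg]
    fun_prop
  have hEre : ∀ z, (Eg z).re = G₁ z := fun z ↦ by simp [hEg]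
  have hEim : ∀ z, (Eg z).im = G₂ z := fun z ↦ by simp [hEg]
  have hEq : EqOn Eg g D := fun z hz ↦ by
    apply Complex.ext
    · rw [hEre, ← hE₁ hz]
    · rw [hEim, ← hE₂ hz]
  -- `Eg` is real on the diameter
  have hEreal : ∀ z ∈ ball (x : ℂ) (r / 2), z.im = 0 → (Eg z).im = 0 := by
    intro z hz hzim
    have hev := eventually_add_mul_I_mem hz hzim.ge
    have ht₁ : Tendsto (fun y : ℝ ↦ (Eg (z + y * I)).im) (𝓝[>] 0) (𝓝 (Eg z).im) := by
      have hc : Continuous fun y : ℝ ↦ (Eg (z + y * I)).im := by fun_prop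
      have := hc.tendsto 0
      simp only [ofReal_zero, zero_mul, add_zero] at this
      exact this.mono_left nhdsWithin_le_nhds
    have ht₂ : Tendsto (fun y : ℝ ↦ (Eg (z + y * I)).im) (𝓝[>] 0) (𝓝 0) := by
      have hy : Tendsto (fun y : ℝ ↦ y) (𝓝[>] (0 : ℝ)) (𝓝 0) :=
        tendsto_id.mono_left nhdsWithin_le_nhds
      refine tendsto_of_tendsto_of_tendsto_of_le_of_le' tendsto_const_nhds hy ?_ ?_
      · filter_upwards [hev] with y hy
        rw [hEq hy]
        exact (him _ (hDsub hy)).1.le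
      · filter_upwards [hev] with y hy
        rw [hEq hy]
        have := (him _ (hDsub hy)).2
        simpa [hzim] using this
    exact tendsto_nhds_unique ht₁ ht₂
  -- the reflection
  refine ⟨schwarzReflection Eg, ?_, ?_, ?_, ?_, ?_⟩
  · refine differentiableOn_schwarzReflection isOpen_ball (fun z hz ↦ ?_) hEcont.continuousOn
      ((hd.mono hDsub).congr fun z hz ↦ hEq hz) fun z hz hzim ↦ conj_eq_iff_im.2 (hEreal z hz hzim)
    rw [mem_ball, dist_eq_norm, ← conj_ofReal, ← map_sub, norm_conj, ← dist_eq_norm]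
    exact hz
  · intro z hz
    rw [schwarzReflection_of_nonneg (le_of_lt hz.2), hEq hz]
  · intro z hz hzim
    rw [schwarzReflection_of_nonneg hzim.ge, hEreal z hz hzim]
  · intro z hz hzim
    rw [im_schwarzReflection_of_neg hzim, neg_lt_zero]
    have hcz : conj z ∈ D := by
      refine ⟨?_, ?_⟩
      · rw [mem_ball, dist_eq_norm, ← conj_ofReal, ← map_sub, norm_conj, ← dist_eq_norm]
        exact hz
      · show 0 < (conj z).im
        rw [conj_im]
        linarith
    rw [hEq hcz]
    exact (him _ (hDsub hcz)).1
  · intro a ha haim b hb hbim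
    rw [schwarzReflection_of_nonneg haim, schwarzReflection_of_nonneg hbim]
    have h1 := hG₁.dist_le_mul a b
    have h2 := hG₂.dist_le_mul a b
    rw [Real.dist_eq] at h1 h2
    rw [dist_eq_norm] at h1 h2
    have hsub : Eg a - Eg b = ((G₁ a - G₁ b : ℝ) : ℂ) + ((G₂ a - G₂ b : ℝ) : ℂ) * I := by
      simp only [hEg]
      push_cast
      ring
    rw [hsub]
    calc ‖((G₁ a - G₁ b : ℝ) : ℂ) + ((G₂ a - G₂ b : ℝ) : ℂ) * I‖
        ≤ ‖((G₁ a - G₁ b : ℝ) : ℂ)‖ + ‖((G₂ a - G₂ b : ℝ) : ℂ) * I‖ := norm_add_le _ _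
      _ = |G₁ a - G₁ b| + |G₂ a - G₂ b| := by
          rw [norm_mul, norm_I, mul_one, norm_real, norm_real, Real.norm_eq_abs,
            Real.norm_eq_abs]
      _ ≤ 2 * ‖a - b‖ + 2 * ‖a - b‖ := add_le_add (by exact_mod_cast h1) (by exact_mod_cast h2)
      _ = 4 * ‖a - b‖ := by ring

end Extension

end Complex
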